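import Summits.ABC.IUTFork.Joshi.ATS1ConnectednessCohomology

/-!
# Cor. 8.5.1's collation runs over the full automorphism group `Aut(Π^temp(X/E))` — a proof-only note for the D-10 dictionary
# (companion of `Joshi/ATS1ConnectednessCohomology.lean`, p430942)

Block E of the abc-iut cell (rung LADDER-ABC:A2.E; seat abc-iut-E-t13, slot T-49). K. Joshi, *Construction of Arithmetic Teichmüller
Spaces I*, arXiv:2106.11452v4 (UNREFEREED, disputed; `Joshi2021ATS1`), Cor. 8.5.1 p. 46 l. 9–26: the collated set `Ψ ⊂ H^i(G_E, Ẑ(1))`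
is «the union of the images of each element of `Ψ_s` … under ALL the isomorphisms provided by Theorem 8.4.1», i.e. under all
anabelomorphisms `Π^temp_{Y/E′;K} ≃ Π^temp_{X/E;ℂ_p}` (typed: `KummerGaloisCohomology.CohTransport.collate`, union over all `φ : A.Y.PiTemp
≃ₜ* X.PiTemp`). RECORDED HERE IN KERNEL (for E-t18's `DictionaryCollation` / E-PLAN D-10 «collation ↦ ⟨(Ind1)∪(Ind2)⟩», the
load-bearing dictionary row; no binding of OUR interface, R14): for each object `s` the anabelomorphisms used are EXACTLY the
translates `α_s ∘ σ` of its label by the topological automorphisms `σ` of `Π^temp(X/E)` — so the collation of the classes of ONE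
object is the orbit-union over `Aut_top(Π^temp(X/E))` (`collate_singleton`), and the whole collation is the union of these orbit-unions
over `s ∈ S` (`collate_eq_iUnion_orbit`). Which subgroup of `Aut(Π^temp)` the indeterminacies (Ind1), (Ind2) of [IUTchIII] Thm. 3.11
correspond to is the dictionary question — located, not adjudicated. All PROVED; nothing asserted; no side taken on [IUTchIII]
Cor. 3.12, on Joshi's claims or on Mochizuki's reports; typed ≠ proved ≠ endorsed. Standard axioms; sorry-free.
-/

noncomputable section

open Set

namespace Summit.ABC.IUTFork.Joshi

open Literature.AnabelianGeometry.SemiGraphs (TemperedCurve)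

namespace KummerGaloisCohomology.CohTransport

variable {p : ℕ} [Fact p.Prime] {X : TemperedCurve p} {HPi HG HGQ : ℕ → ATSObj X → Type} [∀ i A, AddCommGroup (HPi i A)]
  [∀ i A, AddCommGroup (HG i A)] [∀ i A, AddCommGroup (HGQ i A)] [∀ i A, Module ℚ_[p] (HGQ i A)]
  {C : KummerGaloisCohomology X HPi HG HGQ} (T : CohTransport C)

/-- Every anabelomorphism `φ : Π^temp(Y/E′) ≅ Π^temp(X/E)` of an object is its label followed by an automorphism of `Π^temp(X/E)`:
`φ = α ∘> (α⁻¹ ∘> φ)`. [folklore] -/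
theorem anabelomorphism_eq_label_trans (A : ATSObj X) (φ : A.Y.PiTemp ≃ₜ* X.PiTemp) :
    A.α.trans (A.α.symm.trans φ) = φ :=
  ContinuousMulEquiv.ext fun g => by
    simp only [ContinuousMulEquiv.trans_apply, ContinuousMulEquiv.symm_apply_apply]

/-- **Cor. 8.5.1 for ONE object = the orbit-union over `Aut_top(Π^temp(X/E))`**: the classes of `s` collate to
`⋃_{σ ∈ Aut(Π^temp(X/E))} (transport along α_s ∘> σ)(Ψ_s)`. PROVED. [folklore] -/
theorem collate_singleton (i : ℕ) (A : ATSObj X) (Ψ : ∀ B : ATSObj X, Set (HG i B)) :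
    T.collate i {A} Ψ = ⋃ σ : X.PiTemp ≃ₜ* X.PiTemp, T.trG A (A.α.trans σ) i '' Ψ A := by
  ext c
  rw [T.mem_collate_iff]
  simp only [Set.mem_singleton_iff, exists_eq_left, Set.mem_iUnion, Set.mem_image]
  constructor
  · rintro ⟨φ, x, hx, rfl⟩
    exact ⟨A.α.symm.trans φ, x, hx, by rw [anabelomorphism_eq_label_trans]⟩
  · rintro ⟨σ, x, hx, rfl⟩
    exact ⟨A.α.trans σ, x, hx, rfl⟩

/-- The collation over a collection `S` is the union over `s ∈ S` of the single-object collations. PROVED. [folklore] -/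
theorem collate_eq_iUnion_singleton (i : ℕ) (S : Set (ATSObj X)) (Ψ : ∀ B : ATSObj X, Set (HG i B)) :
    T.collate i S Ψ = ⋃ A ∈ S, T.collate i {A} Ψ := by
  ext c
  simp only [collate, Set.mem_iUnion, Set.mem_singleton_iff, exists_prop, exists_eq_left]

/-- **Cor. 8.5.1 = union over `s ∈ S` of `Aut_top(Π^temp(X/E))`-orbit-unions** — the indeterminacy group of Joshi's local collation
is the full topological automorphism group of `Π^temp(X/E)` acting through the labels. PROVED. [folklore] -/
theorem collate_eq_iUnion_orbit (i : ℕ) (S : Set (ATSObj X)) (Ψ : ∀ B : ATSObj X, Set (HG i B)) :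
    T.collate i S Ψ = ⋃ A ∈ S, ⋃ σ : X.PiTemp ≃ₜ* X.PiTemp, T.trG A (A.α.trans σ) i '' Ψ A := by
  rw [T.collate_eq_iUnion_singleton]
  refine Set.iUnion_congr fun A => Set.iUnion_congr fun _ => ?_
  exact T.collate_singleton i A Ψ

/-- The standard object's own classes collate through `Aut_top(Π^temp(X/E))` acting on the STANDARD cohomology: with `S =
{standard}`, `Ψ = ⋃_σ (transport along σ)(Ψ_std)` (the label of the standard object is the identity). PROVED. [folklore] -/
theorem collate_standard (i : ℕ) (Ψ : ∀ B : ATSObj X, Set (HG i B)) :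
    T.collate i {ATSObj.standard X} Ψ =
      ⋃ σ : X.PiTemp ≃ₜ* X.PiTemp, T.trG (ATSObj.standard X) σ i '' Ψ (ATSObj.standard X) := by
  rw [T.collate_singleton]
  refine Set.iUnion_congr fun σ => ?_
  have : (ATSObj.standard X).α.trans σ = σ := ContinuousMulEquiv.ext fun g => rfl
  rw [this]

end KummerGaloisCohomology.CohTransport

end Summit.ABC.IUTFork.Joshi

end
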